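import Summits.AtomisticToContinuum.BoseEinsteinCondensation.Theorems.BECGroundStateSOSPeriodicIRBoundFsumDCTautology
import Summits.AtomisticToContinuum.BoseEinsteinCondensation.Theorems.BECGroundStateSOSPeriodicIRBoundFsumDCPotPair
import Summits.AtomisticToContinuum.BoseEinsteinCondensation.Theorems.BECConjugateDominationIMUChainGlueEnergy
import HarnessLib

/-!
# Crux `PeriodicIRBound` (stmt-AtomisticToContinuum-3972), line `fsum-phase-pencil`, stub S3
# `stub_phaseDoubleCommutator` — part 4: assembly of the phase double commutator bound

S3 (`PhaseDoubleCommutator`: `Q_{E₀}(U_kΨ) ≤ C·N·(‖k̃‖² + ρ) + ε` for `δ`-near-minimisers, uniformly over the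
potential class `𝒱(R₀, V₁)`) from three inputs of the potential part, taken here as HYPOTHESES:

* (BODY) the near/far reduction of the potential double commutator
  `𝒫 = C(N,2) · (Re pf(AΨ, AΨ) + Re pf(A′Ψ, A′Ψ) + Re pf(A′AΨ, Ψ) + Re pf(AA′Ψ, Ψ))`, `A = liftOp {0,1} k 0 0 (−k)`,
  `A′ = liftOp {0,1} (−k) 0 0 k` (the near lifts of the pair `(0, 1)`);
* (PAIRS) the pair reduction `P_w[f] = C(N,2) Re pf(f, f)` for Bose-symmetric `f`;
* (NEAR) the smoothing bounds `Re pf(AΨ, AΨ) ≤ 16 (‖w‖₁/L³) ‖Ψ‖²`, `Re pf(A′AΨ, A′AΨ) ≤ 256 (‖w‖₁/L³) ‖Ψ‖²`.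

Assembly at fixed `(N, L)`, `N = m + 3`: symmetrise `Q(U_kΨ) ≤ Q(U_kΨ) + Q(U_{−k}Ψ) = 𝒦 + 𝒫 − (𝒟₁ + 𝒟₂)`
(`eform_add_eform_phaseUp_eq`), `𝒦 ≤ 2N‖k̃‖²` (`kinetic_doubleCommutator_le`),
`𝒫 ≤ 48 C(N,2) ‖w‖₁/L³ + 16 P_w[Ψ]` (Cauchy–Schwarz for the pair form and `ab ≤ ((a+b)/2)²`),
`P_w[Ψ] ≤ 𝓔_w[Ψ] ≤ E₀ + δ`, `−𝒟ᵢ ≤ √δ √𝓔_w[gᵢ]` (`neg_defect_le`) with `𝓔_w[gᵢ] ≤ Kᵢ (E₀ + 2)`; then the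
Hartree bound `E₀ ≤ C(N,2) ‖w‖₁/L³` (constant trial state, `periodicGroundStateEnergy_le_pairs`) and
`L³ = N/ρ`, `‖w‖₁ ≤ V₁` give `Q(U_kΨ) ≤ 2N‖k̃‖² + 32 N ρ V₁ + ε`. Registered stub `stub_fsumDCAssembly`.
-/

noncomputable section

open MeasureTheory Filter
open scoped ENNReal NNReal ComplexConjugate BigOperators

namespace Summit.AtomisticToContinuum.BoseEinsteinCondensation.Cruxes.PeriodicIRBound.FsumPhasePencil

open Literature.MathematicalPhysics.QuantumManyBody.BoseGas
open Summit.AtomisticToContinuum.BoseEinsteinCondensation.Theorems.PeriodicIRBound.Negative (NearMin InWindow)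
open Summit.AtomisticToContinuum.BoseEinsteinCondensation.Theorems.IMUChainGlue (periodicGroundStateEnergy_le_pairs)
open Summit.AtomisticToContinuum.BoseEinsteinCondensation.Cruxes.PeriodicIRBound.LinearPhFloorWagner.WF

/-! ## Real bookkeeping -/

/-- Bookkeeping of the potential double commutator: with `P > 0`, `T₁, T₂ ≤ 16Xn`, `Tᵢ² ≤ Gᵢ q` (`i = 3, 4`),
`Gᵢ ≤ 256Xn` and `V = Pq`, one has `P(T₁ + T₂ + T₃ + T₄) ≤ 48PXn + 16V` (`P|T₃| ≤ √(16PXn · 16V) ≤ 8PXn + 8V`).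
[folklore] -/
theorem pot_doubleCommutator_algebra {P X n V q T₁ T₂ T₃ T₄ G₁ G₂ : ℝ} (hP : 0 < P) (hX : 0 ≤ X) (hn : 0 ≤ n)
    (hV : 0 ≤ V) (hT₁ : T₁ ≤ 16 * X * n) (hT₂ : T₂ ≤ 16 * X * n) (hT₃ : T₃ ^ 2 ≤ G₁ * q)
    (hT₄ : T₄ ^ 2 ≤ G₂ * q) (hG₁ : G₁ ≤ 256 * X * n) (hG₂ : G₂ ≤ 256 * X * n) (hVq : V = P * q) :
    P * (T₁ + T₂ + T₃ + T₄) ≤ 48 * P * X * n + 16 * V := by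
  have hq : 0 ≤ q := by
    by_contra h
    have : P * q < 0 := mul_neg_of_pos_of_neg hP (lt_of_not_ge h)
    linarith
  have key : ∀ {T G : ℝ}, T ^ 2 ≤ G * q → G ≤ 256 * X * n → P * T ≤ 8 * P * X * n + 8 * V := by
    intro T G hT hG
    have hR : 0 ≤ 8 * P * X * n + 8 * V := by positivity
    refine (le_abs_self _).trans (abs_le_of_sq_le_sq ?_ hR)
    have h1 : 0 ≤ P ^ 2 * (G * q - T ^ 2) := mul_nonneg (sq_nonneg P) (sub_nonneg.2 hT)
    have h2 : 0 ≤ P ^ 2 * ((256 * X * n - G) * q) := mul_nonneg (sq_nonneg P) (mul_nonneg (sub_nonneg.2 hG) hq)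
    have h3 : 0 ≤ (P * X * n - V) ^ 2 := sq_nonneg _
    rw [hVq] at h3 ⊢
    nlinarith [h1, h2, h3]
  have h₃ := key hT₃ hG₁
  have h₄ := key hT₄ hG₂
  nlinarith [mul_le_mul_of_nonneg_left hT₁ hP.le, mul_le_mul_of_nonneg_left hT₂ hP.le]

/-- Choice of the slack: with `0 < s ≤ 1`, `s (√M₁ + √M₂ + 17) ≤ ε` and `√Qᵢ ≤ √Mᵢ`,
`16 s² + s (√Q₁ + √Q₂) ≤ ε`. [folklore] -/
theorem slack_algebra {s ε Q₁ Q₂ M₁ M₂ : ℝ} (hs0 : 0 < s) (hs1 : s ≤ 1)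
    (hsS : s * (Real.sqrt M₁ + Real.sqrt M₂ + 17) ≤ ε) (h₁ : Real.sqrt Q₁ ≤ Real.sqrt M₁)
    (h₂ : Real.sqrt Q₂ ≤ Real.sqrt M₂) : 16 * s ^ 2 + s * (Real.sqrt Q₁ + Real.sqrt Q₂) ≤ ε := by
  have hss : s * s ≤ s := mul_le_of_le_one_left hs0.le hs1
  nlinarith [mul_le_mul_of_nonneg_left h₁ hs0.le, mul_le_mul_of_nonneg_left h₂ hs0.le]

/-- Final bookkeeping: with `L³ = N/ρ`, `‖w‖₁ ≤ V₁`, `E₀ ≤ C(N,2) ‖w‖₁/L³` (`N = m + 3`):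
`2N‖k̃‖² + 48 C(N,2) ‖w‖₁/L³ + 16 E₀ + ε ≤ (2 + 32 V₁) N (‖k̃‖² + ρ) + ε`. [folklore] -/
theorem phaseDoubleCommutator_algebra {m ρ V₁ W L kk E ε : ℝ} (hm : 0 ≤ m) (hρ : 0 < ρ) (hV₁ : 0 ≤ V₁)
    (hW : W ≤ V₁) (hL : 0 < L) (hL3 : (m + 3) / L ^ 3 = ρ) (hkk : 0 ≤ kk)
    (hE : E ≤ (m + 3) * (m + 2) / 2 * (W / L ^ 3)) :
    2 * (m + 3) * kk + 48 * ((m + 3) * (m + 2) / 2) * (W / L ^ 3) + 16 * E + ε ≤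
      (2 + 32 * V₁) * (m + 3) * (kk + ρ) + ε := by
  have hL3p : 0 < L ^ 3 := by positivity
  have hm3 : (0 : ℝ) < m + 3 := by linarith
  have hX : W / L ^ 3 = W * ρ / (m + 3) := by
    rw [← hL3]
    field_simp
  have hPX : (m + 3) * (m + 2) / 2 * (W / L ^ 3) = (m + 2) * (W * ρ) / 2 := by
    rw [hX]
    field_simp
  have hWρ : (m + 2) * (W * ρ) ≤ (m + 3) * (V₁ * ρ) := by
    nlinarith [mul_le_mul_of_nonneg_right hW hρ.le, mul_nonneg hV₁ hρ.le]
  nlinarith [hPX, hE, hWρ, mul_nonneg hm3.le hρ.le, mul_nonneg (mul_nonneg hV₁ hm3.le) hkk]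

/-- `C(m+3, 2) = (m+3)(m+2)/2` as a real number. [folklore] -/
theorem cast_choose_two_add_three (m : ℕ) : (((m + 3).choose 2 : ℕ) : ℝ) = (m + 3) * (m + 2) / 2 := by
  rw [Nat.cast_choose_two ℝ (m + 3)]
  push_cast
  ring

/-! ## The Hartree bound in reals -/

/-- **Hartree bound** (constant trial state): `E₀(m+3, L) ≤ C(m+3, 2) · ‖w‖₁ / L³` as real numbers, for
measurable `w` with `‖w‖₁ < ∞`. [folklore] -/
theorem toReal_periodicGroundStateEnergy_le_pairs {L : ℝ} {w : ℝ → ℝ≥0∞} (hL : 0 < L) (hw : Measurable w)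
    (hint : (∫⁻ z : Space, w ‖z‖) ≠ ⊤) (m : ℕ) :
    (periodicGroundStateEnergy w (m + 3) L).toReal ≤
      ((m + 3) * (m + 2) / 2 : ℝ) * ((∫⁻ z : Space, w ‖z‖).toReal / L ^ 3) := by
  have h : periodicGroundStateEnergy w (m + 3) L ≤
      (((m + 3).choose 2 : ℕ) : ℝ≥0∞) * ((ENNReal.ofReal L ^ 3)⁻¹ * ∫⁻ z : Space, w ‖z‖) :=
    periodicGroundStateEnergy_le_pairs hL hw (m + 1)
  have hL3 : (ENNReal.ofReal L ^ 3)⁻¹ ≠ ⊤ := ENNReal.inv_ne_top.2 (pow_ne_zero _ (ENNReal.ofReal_pos.2 hL).ne')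
  have hne : (((m + 3).choose 2 : ℕ) : ℝ≥0∞) * ((ENNReal.ofReal L ^ 3)⁻¹ * ∫⁻ z : Space, w ‖z‖) ≠ ⊤ :=
    ENNReal.mul_ne_top (ENNReal.natCast_ne_top _) (ENNReal.mul_ne_top hL3 hint)
  have h' := ENNReal.toReal_mono hne h
  rw [ENNReal.toReal_mul, ENNReal.toReal_mul, ENNReal.toReal_natCast, ENNReal.toReal_inv, ENNReal.toReal_pow,
    ENNReal.toReal_ofReal hL.le, cast_choose_two_add_three] at h'
  calc (periodicGroundStateEnergy w (m + 3) L).toReal ≤ _ := h'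
    _ = _ := by ring

/-! ## Assembly from the three potential inputs -/

section Assembly

variable
  (hbody : ∀ {m : ℕ} {L : ℝ} {w : ℝ → ℝ≥0∞}, 0 < L → Measurable w → (∫⁻ z : Space, w ‖z‖) ≠ ⊤ → ∀ (k : Fin 3 → ℤ) {Ψ : Config (m + 3) → ℂ}, IsCore L Ψ → (potForm w L (phaseUp L k Ψ)).toReal + (potForm w L (phaseUp L (-k) Ψ)).toReal + potRe w L (phaseUp L (-k) (phaseUp L k Ψ)) Ψ + potRe w L (phaseUp L k (phaseUp L (-k) Ψ)) Ψ = ((m + 3) * (m + 2) / 2 : ℝ) * ((pairForm w L (liftOp L ({0, 1} : Finset (Fin (m + 3))) k 0 0 (-k) Ψ) (liftOp L ({0, 1} : Finset (Fin (m + 3))) k 0 0 (-k) Ψ)).re + (pairForm w L (liftOp L ({0, 1} : Finset (Fin (m + 3))) (-k) 0 0 k Ψ) (liftOp L ({0, 1} : Finset (Fin (m + 3))) (-k) 0 0 k Ψ)).re + (pairForm w L (liftOp L ({0, 1} : Finset (Fin (m + 3))) (-k) 0 0 k (liftOp L ({0, 1} : Finset (Fin (m + 3))) k 0 0 (-k)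 Ψ)) Ψ).re + (pairForm w L (liftOp L ({0, 1} : Finset (Fin (m + 3))) k 0 0 (-k) (liftOp L ({0, 1} : Finset (Fin (m + 3))) (-k) 0 0 k Ψ)) Ψ).re))
  (hpairs : ∀ {m : ℕ} {L : ℝ} {w : ℝ → ℝ≥0∞}, 0 < L → Measurable w → (∫⁻ z : Space, w ‖z‖) ≠ ⊤ → ∀ {f g : Config (m + 2) → ℂ}, Continuous f → Continuous g → IsSymm f → IsSymm g → potRe w L f g = ((m + 2) * (m + 1) / 2 : ℝ) * (pairForm w L f g).re ∧ (potForm w L f).toReal = ((m + 2) * (m + 1) / 2 : ℝ) * (pairForm w L f f).re)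
  (hnear : ∀ {m : ℕ} {L : ℝ} {w : ℝ → ℝ≥0∞}, 0 < L → Measurable w → (∫⁻ z : Space, w ‖z‖) ≠ ⊤ → ∀ (a b c d a' b' c' d' : Fin 3 → ℤ) {F : Config (m + 2) → ℂ}, Continuous F → (pairForm w L (liftOp L ({0, 1} : Finset (Fin (m + 2))) a b c d F) (liftOp L ({0, 1} : Finset (Fin (m + 2))) a b c d F)).re ≤ 16 * ((∫⁻ z : Space, w ‖z‖).toReal / L ^ 3) * (normSq L F).toReal ∧ (pairForm w L (liftOp L ({0, 1} : Finset (Fin (m + 2))) a' b' c' d' (liftOp L ({0, 1} : Finset (Fin (m + 2))) a b c d F)) (liftOp L ({0, 1} : Finset (Fin (m + 2))) a' b' c' d' (liftOp L ({0, 1} : Finset (Fin (m + 2))) a b c d F))).re ≤ 256 * ((∫⁻ z : Space, w ‖z‖).toReal / L ^ 3) * (normSq L F).toReal)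

include hbody hpairs hnear

/-- **The potential double commutator bound** at fixed `(N, L)`, `N = m + 3`: for a core `Ψ`,
`𝒫 ≤ 48 C(N,2) (‖w‖₁/L³) ‖Ψ‖² + 16 P_w[Ψ]` (from BODY, NEAR, PAIRS, Cauchy–Schwarz for the pair form and
`ab ≤ ((a + b)/2)²`). [folklore] -/
theorem pot_doubleCommutator_le {m : ℕ} {L : ℝ} {w : ℝ → ℝ≥0∞} (hL : 0 < L) (hw : Measurable w)
    (hint : (∫⁻ z : Space, w ‖z‖) ≠ ⊤) (k : Fin 3 → ℤ) {Ψ : Config (m + 3) → ℂ} (hΨ : IsCore L Ψ) :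
    (potForm w L (phaseUp L k Ψ)).toReal + (potForm w L (phaseUp L (-k) Ψ)).toReal +
        potRe w L (phaseUp L (-k) (phaseUp L k Ψ)) Ψ + potRe w L (phaseUp L k (phaseUp L (-k) Ψ)) Ψ ≤
      48 * ((m + 3) * (m + 2) / 2 : ℝ) * ((∫⁻ z : Space, w ‖z‖).toReal / L ^ 3) * (normSq L Ψ).toReal +
        16 * (potForm w L Ψ).toReal := by
  have hΨc : Continuous Ψ := hΨ.contDiff.continuous
  obtain ⟨hT₁, hG₁⟩ := @hnear (m + 1) _ _ hL hw hint k 0 0 (-k) (-k) 0 0 k _ hΨc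
  obtain ⟨hT₂, hG₂⟩ := @hnear (m + 1) _ _ hL hw hint (-k) 0 0 k k 0 0 (-k) _ hΨc
  have hV := (@hpairs (m + 1) _ _ hL hw hint _ _ hΨc hΨc hΨ.symm hΨ.symm).2
  have hVq : (potForm w L Ψ).toReal = ((m + 3) * (m + 2) / 2 : ℝ) * (pairForm w L Ψ Ψ).re := by
    rw [hV]
    push_cast
    ring
  have hA : Continuous (liftOp L ({0, 1} : Finset (Fin (m + 3))) k 0 0 (-k) Ψ) :=
    continuous_liftOp L _ k 0 0 (-k) hΨc
  have hA' : Continuous (liftOp L ({0, 1} : Finset (Fin (m + 3))) (-k) 0 0 k Ψ) :=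
    continuous_liftOp L _ (-k) 0 0 k hΨc
  have hg₁ : Continuous (liftOp L ({0, 1} : Finset (Fin (m + 3))) (-k) 0 0 k
      (liftOp L ({0, 1} : Finset (Fin (m + 3))) k 0 0 (-k) Ψ)) :=
    continuous_liftOp L _ (-k) 0 0 k hA
  have hg₂ : Continuous (liftOp L ({0, 1} : Finset (Fin (m + 3))) k 0 0 (-k)
      (liftOp L ({0, 1} : Finset (Fin (m + 3))) (-k) 0 0 k Ψ)) :=
    continuous_liftOp L _ k 0 0 (-k) hA'
  have hT₃ := pairForm_re_sq_le hL hw hint hg₁ hΨc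
  have hT₄ := pairForm_re_sq_le hL hw hint hg₂ hΨc
  rw [hbody hL hw hint k hΨ]
  exact pot_doubleCommutator_algebra (by positivity) (by positivity) ENNReal.toReal_nonneg ENNReal.toReal_nonneg
    hT₁ hT₂ hT₃ hT₄ hG₁ hG₂ hVq

/-- **The symmetrised estimate for one near-minimiser** (fixed `(N, L)`, `N = m + 3`, slack `δ ≥ 0`):
`Q_{E₀}(U_kΨ) ≤ 2N‖k̃‖² + 48 C(N,2) ‖w‖₁/L³ + 16 (E₀ + δ) + √δ (√𝓔_w[U_{−k}U_kΨ] + √𝓔_w[U_kU_{−k}Ψ])`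
(`Q(U_{−k}Ψ) ≥ 0`, the form tautology, the kinetic and potential double commutator bounds, `P_w[Ψ] ≤ E₀ + δ`,
and the near-minimiser defects). [folklore] -/
theorem eform_phaseUp_le_of_slack {m : ℕ} {L : ℝ} {w : ℝ → ℝ≥0∞} (hL : 0 < L) (hw : Measurable w)
    (hint : (∫⁻ z : Space, w ‖z‖) ≠ ⊤) (hE : periodicGroundStateEnergy w (m + 3) L ≠ ⊤) (k : Fin 3 → ℤ)
    {δ : ℝ} (hδ : 0 ≤ δ) (Ψ : PeriodicTrialState (m + 3) L)
    (hΨ : periodicEnergy w Ψ ≤ periodicGroundStateEnergy w (m + 3) L + ENNReal.ofReal δ) :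
    eform w L (periodicGroundStateEnergy w (m + 3) L).toReal (phaseUp L k Ψ.ψ) ≤
      2 * (m + 3) * ‖waveVector L k‖ ^ 2 +
        48 * ((m + 3) * (m + 2) / 2 : ℝ) * ((∫⁻ z : Space, w ‖z‖).toReal / L ^ 3) +
        16 * ((periodicGroundStateEnergy w (m + 3) L).toReal + δ) +
        Real.sqrt δ * (Real.sqrt ((qform w L (phaseUp L (-k) (phaseUp L k Ψ.ψ))).toReal) +
          Real.sqrt ((qform w L (phaseUp L k (phaseUp L (-k) Ψ.ψ))).toReal)) := by
  have hEt : periodicGroundStateEnergy w (m + 3) L + ENNReal.ofReal δ ≠ ⊤ :=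
    ENNReal.add_ne_top.2 ⟨hE, ENNReal.ofReal_ne_top⟩
  have hΨc : IsCore L Ψ.ψ := isCore_trialState Ψ
  have hn1 : normSq L Ψ.ψ = 1 := Ψ.norm_eq
  have hn1' : (normSq L Ψ.ψ).toReal = 1 := by rw [hn1, ENNReal.toReal_one]
  have hq : qform w L Ψ.ψ ≤ periodicGroundStateEnergy w (m + 3) L + ENNReal.ofReal δ := hΨ
  have hqt : qform w L Ψ.ψ ≠ ⊤ := ne_top_of_le_ne_top hEt hq
  have hU : IsCore L (phaseUp L k Ψ.ψ) := isCore_phaseUp hL k hΨc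
  have hU' : IsCore L (phaseUp L (-k) Ψ.ψ) := isCore_phaseUp hL (-k) hΨc
  have hg₁ : IsCore L (phaseUp L (-k) (phaseUp L k Ψ.ψ)) := isCore_phaseUp hL (-k) hU
  have hg₂ : IsCore L (phaseUp L k (phaseUp L (-k) Ψ.ψ)) := isCore_phaseUp hL k hU'
  have hUt : qform w L (phaseUp L k Ψ.ψ) ≠ ⊤ := qform_phaseUp_ne_top hL hw hint k hΨc hqt
  have hU't : qform w L (phaseUp L (-k) Ψ.ψ) ≠ ⊤ := qform_phaseUp_ne_top hL hw hint (-k) hΨc hqt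
  have hg₁t : qform w L (phaseUp L (-k) (phaseUp L k Ψ.ψ)) ≠ ⊤ := qform_phaseUp_ne_top hL hw hint (-k) hU hUt
  have hg₂t : qform w L (phaseUp L k (phaseUp L (-k) Ψ.ψ)) ≠ ⊤ := qform_phaseUp_ne_top hL hw hint k hU' hU't
  -- (a) the partner is in the cone
  have h0 : 0 ≤ eform w L (periodicGroundStateEnergy w (m + 3) L).toReal (phaseUp L (-k) Ψ.ψ) :=
    stub_eformNonneg w hU' hU't
  -- (b) the tautology
  have htaut := eform_add_eform_phaseUp_eq hw (periodicGroundStateEnergy w (m + 3) L).toReal k hΨc hU hU' hg₁ hg₂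
    (potForm_ne_top_of_qform w hqt) (potForm_ne_top_of_qform w hUt) (potForm_ne_top_of_qform w hU't)
    (potForm_ne_top_of_qform w hg₁t) (potForm_ne_top_of_qform w hg₂t)
  -- (c) the kinetic double commutator
  have hkin := kinetic_doubleCommutator_le hL k hΨc hU hU'
  rw [hn1'] at hkin
  push_cast at hkin
  -- (d) the potential double commutator
  have hpot := pot_doubleCommutator_le hbody hpairs hnear hL hw hint k hΨc
  rw [hn1'] at hpot
  -- real conversions of the near-minimiser hypothesis
  have hq' : (qform w L Ψ.ψ).toReal ≤ (periodicGroundStateEnergy w (m + 3) L).toReal + δ := by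
    have h := ENNReal.toReal_mono hEt hq
    rwa [ENNReal.toReal_add hE ENNReal.ofReal_ne_top, ENNReal.toReal_ofReal hδ] at h
  have hV : (potForm w L Ψ.ψ).toReal ≤ (periodicGroundStateEnergy w (m + 3) L).toReal + δ :=
    (ENNReal.toReal_mono hqt (potForm_le_qform' w L Ψ.ψ)).trans hq'
  have hnear' : (qform w L Ψ.ψ).toReal ≤
      (periodicGroundStateEnergy w (m + 3) L).toReal * (normSq L Ψ.ψ).toReal + δ := by
    rw [hn1', mul_one]
    exact hq'
  -- (f) the defects
  have hD₁ := neg_defect_le hL hw hΨc hg₁ hqt hg₁t hE hδ hnear'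
  have hD₂ := neg_defect_le hL hw hΨc hg₂ hqt hg₂t hE hδ hnear'
  nlinarith [htaut, h0, hkin, hpot, hV, hD₁, hD₂]

/-- **The bound with a chosen slack** (fixed `(N, L)`, `N = m + 3`): for every `ε > 0` there is `δ > 0` with
`Q_{E₀}(U_kΨ) ≤ 2N‖k̃‖² + 48 C(N,2) ‖w‖₁/L³ + 16 E₀ + ε` for every `δ`-near-minimiser `Ψ` (the forms of
`U_{∓k}U_{±k}Ψ` are bounded by `K · (E₀ + 2)` uniformly, `exists_phaseUp_phaseUp_formConst`). [folklore] -/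
theorem exists_slack_eform_phaseUp_le {m : ℕ} {L : ℝ} {w : ℝ → ℝ≥0∞} (hL : 0 < L) (hw : Measurable w)
    (hint : (∫⁻ z : Space, w ‖z‖) ≠ ⊤) (hE : periodicGroundStateEnergy w (m + 3) L ≠ ⊤) (k : Fin 3 → ℤ)
    {ε : ℝ} (hε : 0 < ε) :
    ∃ δ : ℝ≥0∞, 0 < δ ∧ ∀ Ψ : PeriodicTrialState (m + 3) L,
      periodicEnergy w Ψ ≤ periodicGroundStateEnergy w (m + 3) L + δ →
        eform w L (periodicGroundStateEnergy w (m + 3) L).toReal (phaseUp L k Ψ.ψ) ≤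
          2 * (m + 3) * ‖waveVector L k‖ ^ 2 +
            48 * ((m + 3) * (m + 2) / 2 : ℝ) * ((∫⁻ z : Space, w ‖z‖).toReal / L ^ 3) +
            16 * (periodicGroundStateEnergy w (m + 3) L).toReal + ε := by
  obtain ⟨K₁, hK₁, hK₁b⟩ := exists_phaseUp_phaseUp_formConst hL hw hint (m + 2) k (-k)
  obtain ⟨K₂, hK₂, hK₂b⟩ := exists_phaseUp_phaseUp_formConst hL hw hint (m + 2) (-k) k
  have hE2 : periodicGroundStateEnergy w (m + 3) L + 2 ≠ ⊤ := ENNReal.add_ne_top.2 ⟨hE, ENNReal.ofNat_ne_top⟩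
  set M₁ : ℝ := (K₁ * (periodicGroundStateEnergy w (m + 3) L + 2)).toReal with hM₁
  set M₂ : ℝ := (K₂ * (periodicGroundStateEnergy w (m + 3) L + 2)).toReal with hM₂
  have hS : 0 < Real.sqrt M₁ + Real.sqrt M₂ + 17 := by positivity
  set s : ℝ := min 1 (ε / (Real.sqrt M₁ + Real.sqrt M₂ + 17)) with hs
  have hs0 : 0 < s := lt_min one_pos (div_pos hε hS)
  have hs1 : s ≤ 1 := min_le_left _ _
  have hsS : s * (Real.sqrt M₁ + Real.sqrt M₂ + 17) ≤ ε := by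
    rw [← le_div_iff₀ hS]
    exact min_le_right _ _
  refine ⟨ENNReal.ofReal (s ^ 2), ENNReal.ofReal_pos.2 (by positivity), fun Ψ hΨ => ?_⟩
  have h := eform_phaseUp_le_of_slack hbody hpairs hnear hL hw hint hE k (sq_nonneg s) Ψ hΨ
  rw [Real.sqrt_sq hs0.le] at h
  have hΨc : IsCore L Ψ.ψ := isCore_trialState Ψ
  have hδ2 : ENNReal.ofReal (s ^ 2) ≤ 2 :=
    (ENNReal.ofReal_le_one.2 (by nlinarith)).trans one_le_two
  have hD : qform w L Ψ.ψ ≤ periodicGroundStateEnergy w (m + 3) L + 2 :=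
    le_trans (show qform w L Ψ.ψ ≤ _ from hΨ) (add_le_add le_rfl hδ2)
  have hnD : normSq L Ψ.ψ ≤ periodicGroundStateEnergy w (m + 3) L + 2 := by
    rw [show normSq L Ψ.ψ = 1 from Ψ.norm_eq]
    exact one_le_two.trans le_add_self
  have hQ₁ : (qform w L (phaseUp L (-k) (phaseUp L k Ψ.ψ))).toReal ≤ M₁ :=
    ENNReal.toReal_mono (ENNReal.mul_ne_top hK₁ hE2) (hK₁b hΨc hD hnD)
  have hQ₂ : (qform w L (phaseUp L k (phaseUp L (-k) Ψ.ψ))).toReal ≤ M₂ :=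
    ENNReal.toReal_mono (ENNReal.mul_ne_top hK₂ hE2) (hK₂b hΨc hD hnD)
  have key := slack_algebra hs0 hs1 hsS (Real.sqrt_le_sqrt hQ₁) (Real.sqrt_le_sqrt hQ₂)
  linarith

/-- **S3 from the three potential inputs**: `PhaseDoubleCommutator` with `ρ₀ = 1`, `C = 2 + 32 V₁`
(eventually `N ≥ 3`; the Hartree bound `E₀ ≤ C(N,2)‖w‖₁/L³`, `L³ = N/ρ`, `‖w‖₁ ≤ V₁`). [folklore] -/
theorem phaseDoubleCommutator_of_reduction : PhaseDoubleCommutator := by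
  intro R₀ V₁ _ hV₁ κ _
  refine ⟨1, one_pos, 2 + 32 * V₁, by positivity, fun ρ hρ _ => ?_⟩
  filter_upwards [eventually_ge_atTop 3] with N hN
  intro w hw hE k _ ε hε
  obtain ⟨m, rfl⟩ : ∃ m, N = m + 3 := ⟨N - 3, by omega⟩
  have hN0 : 0 < m + 3 := by omega
  have hL : 0 < sideLength ρ (m + 3) := sideLength_pos_of_pos hρ hN0
  have hint : (∫⁻ x : Space, w ‖x‖) ≠ ⊤ := ne_top_of_le_ne_top ENNReal.ofReal_ne_top hw.2.2
  obtain ⟨δ, hδ, H⟩ := exists_slack_eform_phaseUp_le hbody hpairs hnear hL hw.1 hint hE k hε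
  refine ⟨δ, hδ, fun Ψ hΨ => (H Ψ hΨ).trans ?_⟩
  have hW : (∫⁻ x : Space, w ‖x‖).toReal ≤ V₁ :=
    (ENNReal.toReal_mono ENNReal.ofReal_ne_top hw.2.2).trans_eq (ENNReal.toReal_ofReal hV₁)
  have hL3 : ((m : ℝ) + 3) / sideLength ρ (m + 3) ^ 3 = ρ := by
    have h := div_sideLength_pow_three hρ hN0
    push_cast at h
    exact h
  have hE₀ := toReal_periodicGroundStateEnergy_le_pairs hL hw.1 hint m
  push_cast
  exact phaseDoubleCommutator_algebra (Nat.cast_nonneg m) hρ hV₁ hW hL hL3 (sq_nonneg _) hE₀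

end Assembly

/-! ## Registered headline -/

/-- **Registered stub `stub_fsumDCAssembly`** (line `fsum-phase-pencil`, S3 assembly): the phase double
commutator bound `PhaseDoubleCommutator` from the potential reduction (BODY), the pair reduction (PAIRS) and the
near-lift bounds (NEAR). [folklore] -/
theorem stub_fsumDCAssembly : (∀ {m : ℕ} {L : ℝ} {w : ℝ → ℝ≥0∞}, 0 < L → Measurable w → (∫⁻ z : Space, w ‖z‖) ≠ ⊤ → ∀ (k : Fin 3 → ℤ) {Ψ : Config (m + 3) → ℂ}, IsCore L Ψ → (potForm w L (phaseUp L k Ψ)).toReal + (potForm w L (phaseUp L (-k) Ψ)).toReal + potRe w L (phaseUp L (-k) (phaseUp L k Ψ)) Ψ + potRe w L (phaseUp L k (phaseUp L (-k) Ψ)) Ψ = ((m + 3) * (m + 2) / 2 : ℝ) * ((pairForm w L (liftOp L ({0, 1} : Finset (Fin (m + 3))) k 0 0 (-k) Ψ) (liftOp L ({0, 1} : Finset (Fin (m + 3))) k 0 0 (-k) Ψ)).re + (pairForm w L (liftOp L ({0, 1} : Finset (Fin (m + 3))) (-k) 0 0 k Ψ) (liftOp L ({0, 1} : Finset (Fin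 (m + 3))) (-k) 0 0 k Ψ)).re + (pairForm w L (liftOp L ({0, 1} : Finset (Fin (m + 3))) (-k) 0 0 k (liftOp L ({0, 1} : Finset (Fin (m + 3))) k 0 0 (-k) Ψ)) Ψ).re + (pairForm w L (liftOp L ({0, 1} : Finset (Fin (m + 3))) k 0 0 (-k) (liftOp L ({0, 1} : Finset (Fin (m + 3))) (-k) 0 0 k Ψ)) Ψ).re)) → (∀ {m : ℕ} {L : ℝ} {w : ℝ → ℝ≥0∞}, 0 < L → Measurable w → (∫⁻ z : Space, w ‖z‖) ≠ ⊤ → ∀ {f g : Config (m + 2) → ℂ}, Continuous f → Continuous g → IsSymm f → IsSymm g → potRe w L f g = ((m + 2) * (m + 1) / 2 : ℝ) * (pairForm w L f g).re ∧ (potForm w L f).toReal = ((m + 2) * (m + 1) / 2 : ℝ) * (pairForm w L f f).re) → (∀ {m : ℕ} {L : ℝ} {w : ℝ → ℝ≥0∞}, 0 < L → Measurable w → (∫⁻ z : Space, w ‖z‖) ≠ ⊤ → ∀ (a b c d a' b' c' d' : Fin 3 → ℤ) {F : Config (m + 2) → ℂ}, Continuous F → (pairForm w L (liftOp L ({0,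 1} : Finset (Fin (m + 2))) a b c d F) (liftOp L ({0, 1} : Finset (Fin (m + 2))) a b c d F)).re ≤ 16 * ((∫⁻ z : Space, w ‖z‖).toReal / L ^ 3) * (normSq L F).toReal ∧ (pairForm w L (liftOp L ({0, 1} : Finset (Fin (m + 2))) a' b' c' d' (liftOp L ({0, 1} : Finset (Fin (m + 2))) a b c d F)) (liftOp L ({0, 1} : Finset (Fin (m + 2))) a' b' c' d' (liftOp L ({0, 1} : Finset (Fin (m + 2))) a b c d F))).re ≤ 256 * ((∫⁻ z : Space, w ‖z‖).toReal / L ^ 3) * (normSq L F).toReal) → PhaseDoubleCommutator :=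
  fun hbody hpairs hnear => phaseDoubleCommutator_of_reduction hbody hpairs hnear

end Summit.AtomisticToContinuum.BoseEinsteinCondensation.Cruxes.PeriodicIRBound.FsumPhasePencil

end
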